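import Literature.AlgebraicGeometry.Motives.GaloisThickeningPointsGalois
import Literature.AlgebraicGeometry.Motives.IntegralModelReductionMapFrobenius
import HarnessLib

/-!
# The second point of the Frobenius cover: the `σ`-conjugate read on the `γ`-moved sheet reduces to the `q`-Frobenius of the reduction
# (`red_𝓨 (ℓ_{e ∘ γ} (σ • P)) = F̃ (red_𝓨 (ℓ_e P))` when `σ ∘ e = e ∘ γ`; [SerreTate1968] §1 Lemma 2, [Shimura1998] §16.3 (1), [GortzWedhorn2020] (14.20))

Topic `Literature/AlgebraicGeometry/Motives`, namespace `Literature.AlgebraicGeometry.Motives`.  THEOREMS only (no def, no instance, no notation,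
no named fact, no `sorry`).  Cell `hodgecm-mathlib`, P6 «MOD programme», line L3 (D-LINE socket `stub_FROB`, A-p03 (g30) closer skeleton v2
`stub_TWISTCOVER0`, ROAD A «cover clause»): organ **(pt) SECOND-POINT IDENTITY**, `θ`-FREE.  Sequel of ★ `Motives/GaloisThickeningPointsGalois`
(`σ • ℓ_e P = ℓ_{σ ∘ e} (σ • P)`, `smul_thickeningLift`) and ★ `Motives/IntegralModelReductionMapFrobenius` (`red_𝒳 (σ • x) = F̃ (red_𝒳 x)` for an
arithmetic Frobenius `σ` and every proper model, `geomReductionMap_smul_of_isAbsArithFrob`).  HC_CM is proved only modulo the printed citations until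
rung 0 closes; nothing here is about HC (generic, moduli-free).

THE MATHEMATICS.  `K ⊆ L` fields, `X` a `K`-scheme, `R_L X = X ×_K Spec L` its Galois thickening with sections `ℓ_e` indexed by the sheets
`e : L → Ω`.  If `σ ∈ Aut(Ω ∕ K)` reads on the sheet `e` as the deck transformation `γ` (`σ ∘ e = e ∘ γ`), then the `σ`-conjugate of `P ∈ X(Ω)` read on
the MOVED sheet `e ∘ γ` is the `σ`-conjugate of the point `ℓ_e P` of the thickening: **`ℓ_{e ∘ γ} (σ • P) = σ • ℓ_e P`** (§1; `ℓ_{σ ∘ e} = ℓ_{e ∘ γ}`).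
Hence for `K` a number field, `v` a finite place, `Ω = \overline{K_v}`, `𝓨` ANY proper `𝒪_{K,(v)}`-model of `R_L X` and `σ ∈ Γ_{K_v}` an ARITHMETIC
FROBENIUS: **`red_𝓨 (ℓ_{e ∘ γ} (σ • P)) = F̃ (red_𝓨 (ℓ_e P))`** (§2) — the reduction of the second point of the generic Serre cover
`c : A_{ℓ_e (σ • y)} → A_{ℓ_{e ∘ γ} (σ • y)}` (P6a `CoverΩ … (e.comp γ) 𝔞 n (σ • y)`) is the FROBENIUS MOVE `F̃ x̄` of the reduction `x̄ = red₀ y`, so that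
the fibre there is the Frobenius twist `A_x̄^{(q)}` (★ `AbelianSchemeFibreFrobeniusTwist`): the input of the letter `FrobCover₀ … (red₀ (σ • y)) (red₀ y)`.
No model automorphism `θ` and no hypothesis `hθ` enter (contrast ★ `GaloisThickeningFrobeniusSheet`, which corrects the sheet by `θ(γ)_s`).

## Main statements
* `thickeningLift_comp_smul` — `ℓ_{e ∘ γ} (σ • P) = σ • ℓ_e P` for `σ ∈ Aut(Ω ∕ K)` with `σ ∘ e = e ∘ γ`.
* `thickeningLift_comp_adicCompletion_smul` — the same for `σ ∈ Γ_{K_v}` acting on `\overline{K_v}`-points.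
* **`IntegralModel.geomReductionMap_thickeningLift_comp_smul_of_isAbsArithFrob`** — `red_𝓨 (ℓ_{e ∘ γ} (σ • P)) = F̃ (red_𝓨 (ℓ_e P))`.
* `IntegralModel.geomReductionMap_thickeningLift_comp_smul_eq_comp_frobeniusOver` — the same with `F̃ x̄` spelled `x̄ ≫ F̃` (the shape of ★
  `fibreFrobeniusTwistIso … (x ≫ frobeniusOver S)`).

## References
* [SerreTate1968] J.-P. Serre, J. Tate, *Good reduction of abelian varieties*, Ann. of Math. 88 (1968), §1 Lemma 2.
* [Shimura1998] G. Shimura, *Abelian Varieties with Complex Multiplication and Modular Functions* (1998), §16.3 (1), §18.6 (p. 127).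
* [GortzWedhorn2020] U. Görtz, T. Wedhorn, *Algebraic Geometry I* (2nd ed. 2020), §(4.8)–(4.9), (14.20).
-/

set_option autoImplicit false

noncomputable section

open CategoryTheory _root_.AlgebraicGeometry Limits IsDedekindDomain IsDedekindDomain.HeightOneSpectrum Field
open scoped NumberField
open Literature.NumberTheory.GaloisRepresentations (IsAbsArithFrob)
open Literature.NumberTheory.DiophantineGeometry

universe u

namespace Literature.AlgebraicGeometry.Motives

/-! ## §1 The `σ`-conjugate on the moved sheet -/

section Sheet

variable {K L : Type u} [Field K] [Field L] [Algebra K L] {Ω : Type u} [Field Ω] [Algebra K Ω]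

/-- **`ℓ_{e ∘ γ} (σ • P) = σ • ℓ_e P`** when `σ ∘ e = e ∘ γ`: the `σ`-conjugate of `P` read on the moved sheet `e ∘ γ` is the `σ`-conjugate of the
point `ℓ_e P` of the thickening (★ `smul_thickeningLift`: `σ • ℓ_e P = ℓ_{σ ∘ e} (σ • P)`). [cite: GortzWedhorn2020, §(4.8)–(4.9), (14.20)] -/
theorem thickeningLift_comp_smul (σ : Ω ≃ₐ[K] Ω) (e : L →ₐ[K] Ω) (γ : L ≃ₐ[K] L)
    (hγ : (σ : Ω →ₐ[K] Ω).comp e = e.comp (γ : L →ₐ[K] L)) (X : SchemeOver K) (P : AlgPoints X Ω) :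
    thickeningLift (e.comp (γ : L →ₐ[K] L)) X (σ • P) = σ • thickeningLift e X P := by
  rw [← hγ, smul_thickeningLift]

end Sheet

section Local

variable {K : Type} [Field K] [NumberField K] {v : HeightOneSpectrum (𝓞 K)} {L : Type} [Field L] [Algebra K L]

/-- **`ℓ_{e ∘ γ} (σ • P) = σ • ℓ_e P` for `σ ∈ Γ_{K_v}`** acting on `\overline{K_v}`-points through `Γ_{K_v} → Aut(\overline{K_v} ∕ K)` (★
`AlgPoints.adicCompletion_smul_def`), when `σ ∘ e = e ∘ γ`. [cite: GortzWedhorn2020, §(4.8)–(4.9), (14.20)] -/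
theorem thickeningLift_comp_adicCompletion_smul (σ : absoluteGaloisGroup (v.adicCompletion K))
    (e : L →ₐ[K] AlgebraicClosure (v.adicCompletion K)) (γ : L ≃ₐ[K] L)
    (hγ : ((AlgEquiv.restrictScalars K (absoluteGaloisGroup.toAlgEquiv (v.adicCompletion K) σ) :
        AlgebraicClosure (v.adicCompletion K) ≃ₐ[K] AlgebraicClosure (v.adicCompletion K)) :
        AlgebraicClosure (v.adicCompletion K) →ₐ[K] AlgebraicClosure (v.adicCompletion K)).comp e = e.comp (γ : L →ₐ[K] L))
    (X : SchemeOver K) (P : AlgPoints X (AlgebraicClosure (v.adicCompletion K))) :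
    thickeningLift (e.comp (γ : L →ₐ[K] L)) X (σ • P) = σ • thickeningLift e X P := by
  rw [AlgPoints.adicCompletion_smul_def, AlgPoints.adicCompletion_smul_def, ← hγ, smul_thickeningLift]

namespace IntegralModel

/-! ## §2 Reduction: the second point of the Frobenius cover reduces to `F̃ x̄` -/

/-- **`red_𝓨 (ℓ_{e ∘ γ} (σ • P)) = F̃ (red_𝓨 (ℓ_e P))`.**  `𝓨` ANY proper `𝒪_{K,(v)}`-model of the thickening `R_L X`, `σ ∈ Γ_{K_v}` an ARITHMETIC
FROBENIUS (★ `IsAbsArithFrob`), `e` a sheet and `γ ∈ Aut(L ∕ K)` with `σ ∘ e = e ∘ γ`.  Then the reduction of the `σ`-conjugate of `P` read on the moved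
sheet `e ∘ γ` is the `q_v`-Frobenius `F̃` (★ `frobeniusOver`) of the reduction of `ℓ_e P`: `ℓ_{e ∘ γ} (σ • P) = σ • ℓ_e P` (§1) and `red_𝓨 ∘ σ = F̃ ∘ red_𝓨` (★
`geomReductionMap_smul_of_isAbsArithFrob`).  `θ`-free: no model automorphism is used. [cite: SerreTate1968, §1 Lemma 2] [cite: Shimura1998, §16.3 (1)]
[cite: GortzWedhorn2020, (14.20)] -/
theorem geomReductionMap_thickeningLift_comp_smul_of_isAbsArithFrob (X : SchemeOver K)
    (𝓨 : IntegralModel (valuationSubringAtPrime K v) K ((thickening K L).obj X)) [IsProper 𝓨.total.hom]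
    {σ : absoluteGaloisGroup (v.adicCompletion K)} (hσ : IsAbsArithFrob σ)
    (e : L →ₐ[K] AlgebraicClosure (v.adicCompletion K)) (γ : L ≃ₐ[K] L)
    (hγ : ((AlgEquiv.restrictScalars K (absoluteGaloisGroup.toAlgEquiv (v.adicCompletion K) σ) :
        AlgebraicClosure (v.adicCompletion K) ≃ₐ[K] AlgebraicClosure (v.adicCompletion K)) :
        AlgebraicClosure (v.adicCompletion K) →ₐ[K] AlgebraicClosure (v.adicCompletion K)).comp e = e.comp (γ : L →ₐ[K] L))
    (P : AlgPoints X (AlgebraicClosure (v.adicCompletion K))) :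
    𝓨.geomReductionMap (thickeningLift (e.comp (γ : L →ₐ[K] L)) X (σ • P)) =
      AlgPoints.map (frobeniusOver 𝓨.reductionAt) (𝓨.geomReductionMap (thickeningLift e X P)) := by
  rw [thickeningLift_comp_adicCompletion_smul σ e γ hγ X P, 𝓨.geomReductionMap_smul_of_isAbsArithFrob hσ]

/-- The same identity with the Frobenius move spelled as a composite of `κ(v)`-morphisms, `F̃ x̄ = x̄ ≫ F̃` (★ `AlgPoints.map_apply`) — the shape
`x ≫ frobeniusOver S` in which ★ `AbelianSchemeOver.fibreFrobeniusTwistIso` reads the fibre at the moved point as the Frobenius twist `A_x̄^{(q)}`.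
[cite: SerreTate1968, §1 Lemma 2] [cite: Shimura1998, §18.6 (p. 127)] -/
theorem geomReductionMap_thickeningLift_comp_smul_eq_comp_frobeniusOver (X : SchemeOver K)
    (𝓨 : IntegralModel (valuationSubringAtPrime K v) K ((thickening K L).obj X)) [IsProper 𝓨.total.hom]
    {σ : absoluteGaloisGroup (v.adicCompletion K)} (hσ : IsAbsArithFrob σ)
    (e : L →ₐ[K] AlgebraicClosure (v.adicCompletion K)) (γ : L ≃ₐ[K] L)
    (hγ : ((AlgEquiv.restrictScalars K (absoluteGaloisGroup.toAlgEquiv (v.adicCompletion K) σ) :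
        AlgebraicClosure (v.adicCompletion K) ≃ₐ[K] AlgebraicClosure (v.adicCompletion K)) :
        AlgebraicClosure (v.adicCompletion K) →ₐ[K] AlgebraicClosure (v.adicCompletion K)).comp e = e.comp (γ : L →ₐ[K] L))
    (P : AlgPoints X (AlgebraicClosure (v.adicCompletion K))) :
    𝓨.geomReductionMap (thickeningLift (e.comp (γ : L →ₐ[K] L)) X (σ • P)) =
      𝓨.geomReductionMap (thickeningLift e X P) ≫ frobeniusOver 𝓨.reductionAt := by
  rw [𝓨.geomReductionMap_thickeningLift_comp_smul_of_isAbsArithFrob X hσ e γ hγ P, AlgPoints.map_apply]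

/-- Consequently the underlying `κ̄(v)`-points of the base agree: `(red_𝓨 (ℓ_{e ∘ γ} (σ • P))).left = (red_𝓨 (ℓ_e P) ≫ F̃).left` — the equality of
base points along which the special fibre of an abelian scheme over `𝓨_v` at the second cover point is transported (★ `AbelianSchemeOver.fibreCongrPtIso`).
[cite: SerreTate1968, §1 Lemma 2] [cite: GortzWedhorn2020, Section (4.7), Prop. 4.16] -/
theorem geomReductionMap_thickeningLift_comp_smul_left (X : SchemeOver K)
    (𝓨 : IntegralModel (valuationSubringAtPrime K v) K ((thickening K L).obj X)) [IsProper 𝓨.total.hom]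
    {σ : absoluteGaloisGroup (v.adicCompletion K)} (hσ : IsAbsArithFrob σ)
    (e : L →ₐ[K] AlgebraicClosure (v.adicCompletion K)) (γ : L ≃ₐ[K] L)
    (hγ : ((AlgEquiv.restrictScalars K (absoluteGaloisGroup.toAlgEquiv (v.adicCompletion K) σ) :
        AlgebraicClosure (v.adicCompletion K) ≃ₐ[K] AlgebraicClosure (v.adicCompletion K)) :
        AlgebraicClosure (v.adicCompletion K) →ₐ[K] AlgebraicClosure (v.adicCompletion K)).comp e = e.comp (γ : L →ₐ[K] L))
    (P : AlgPoints X (AlgebraicClosure (v.adicCompletion K))) :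
    (𝓨.geomReductionMap (thickeningLift (e.comp (γ : L →ₐ[K] L)) X (σ • P))).left =
      (𝓨.geomReductionMap (thickeningLift e X P) ≫ frobeniusOver 𝓨.reductionAt).left := by
  rw [𝓨.geomReductionMap_thickeningLift_comp_smul_eq_comp_frobeniusOver X hσ e γ hγ P]

end IntegralModel

end Local

end Literature.AlgebraicGeometry.Motives

end
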